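import Summits.BirchSwinnertonDyer.BirchSwinnertonDyer.Theorems.CumulativeHeegnerLeopoldtCumulativeHeegnerInclusionAtThreeCellNoThreeTorsion
import Literature.NumberTheory.EllipticCurves.BurungaleCastellaSkinner2025.HeegnerPointDivisibilityFromCGSProofs
import HarnessLib

/-!
# Route `CumulativeHeegnerLeopoldt`, crux K2 `EisensteinCharacterInvariantsAtThree` (stmt-BirchSwinnertonDyer-24199):
# [TOR] — `E(K)[3] = 0` on the Leopoldt cell, in the RATIONAL-POINT currency of the character cut (helper)

Lead prover `bsd-line-chl-p1` g9 (`--supports 24199`). The character cut of K2 / K2′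
(`EisensteinCharacterInvariantsAtThreeCharacterCut.unitCoeffLe_odd_of_characterCut`, p614352) displays the hypothesis
[TOR] «on the Leopoldt cell (`E/ℚ` of class O6 at `3`, `E[3]` reducible with NON-anomalous rational line `Φ`), over a
Heegner field `K` for `N = N_E` possessing a degree-one prime above `3`, the Mordell–Weil group `E(K)` has no point of
order `3`» in the currency `∀ Q : E_K(K), 3 • Q = 0 → Q = 0` consumed by the [ALG] / [BRram] shapes. This file PROVES
it (so the cut loses one displayed hypothesis): a `K`-rational point `Q ≠ 0` with `3 • Q = 0` has order `3`, its
geometric point is a non-zero element of `E_K[3](K̄)` fixed by `Γ_K` (tree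
`exists_geomTorsion_fixed_of_addOrderOf_eq`, Mazur's «`ℤ/N ⊂ E[N]`»), in particular fixed by the decomposition group
`D_{𝔭}` of any prime `𝔭 ∋ 3` of `K`; but on the cell no non-zero point of `E_K[3]` is `D_{𝔭}`-fixed (K1 lineage,
`CumulativeHeegnerInclusionAtThreeCellNoThreeTorsion.cell_geomTorsion_eq_zero_of_fixed_decomp`: `3 ∣ N` splits
in `K`, the non-anomalous clause transports to `D_{𝔭}`, dévissage along the line). The degree-one binders
(`e = f = 1`) of the displayed hypothesis are idle (any prime of `K` above `3` works).
THEOREMS ONLY; no `def`, no `sorry`; imports no `Theses` module. BSD is not proved for any curve by any of this.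
References: [Mazur1977] Ch. III §5 p. 157; [GreenbergVatsal2000] §2 p. 28; [CastellaGrossiLeeSkinner2022] Lemma 1.3.1
(«Lemma 16»: `E(K_w)[p] = 0` from `φ|_{G_p} ≠ 𝟙, ω`).
-/

set_option autoImplicit false
-- `…BirchSwinnertonDyer.BirchSwinnertonDyer.Theorems…` is the problem's mandated namespace (D-0017).
set_option linter.dupNamespace false

noncomputable section

open scoped Classical

namespace Summit.BirchSwinnertonDyer.BirchSwinnertonDyer.Theorems.EisensteinCharacterInvariantsAtThreeCellTorsion

open WeierstrassCurve NumberField IsDedekindDomain Field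
  Literature.NumberTheory.EllipticCurves
  Summit.BirchSwinnertonDyer.BirchSwinnertonDyer.Theorems.CumulativeHeegnerInclusionAtThreeCellNoThreeTorsion

/-- **[TOR] — `E(K)[3] = 0` on the Leopoldt cell (rational-point currency).** For `E/ℚ` globally minimal of class O6
at `3` with `E[3]` reducible and a NON-anomalous rational `3`-line, `K` imaginary quadratic Heegner for `N = N_E` and
`𝔭 ∋ 3` a (degree-one) prime of `K`: every `Q ∈ E(K)` with `3 • Q = 0` is `0`. This is VERBATIM the displayed
hypothesis `htor` of `EisensteinCharacterInvariantsAtThreeCharacterCut.unitCoeffLe_odd_of_characterCut` (p614352).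
Proof: Mazur's geometric point of a rational point of order `3` is `Γ_K`-fixed and non-zero in `E_K[3]`, contradicting
`cell_geomTorsion_eq_zero_of_fixed_decomp` (no non-zero `D_𝔭`-fixed point of `E_K[3]` on the cell).
[cite: Mazur1977, Ch. III §5 p. 157] [cite: GreenbergVatsal2000, §2 p. 28] -/
theorem cell_noThreeTorsion_rational :
    ∀ (W : WeierstrassCurve ℚ) [W.IsElliptic] [W.IsGloballyMinimal] (N : ℕ) [NeZero N] (K : Type) [Field K] [NumberField K], Summit.BirchSwinnertonDyer.Rank1Residual.Additive.ClassO6 W 3 → Literature.NumberTheory.EllipticCurves.Rank1Residual.Red W 3 → (∃ Φ : AddSubgroup (WeierstrassCurve.geomTorsion W ((3 : ℕ) : ℤ)), Literature.NumberTheory.EllipticCurves.Rank1Residual.IsRationalLine W 3 Φ ∧ ∀ (v : IsDedekindDomain.HeightOneSpectrum (NumberField.RingOfIntegers ℚ)), ((3 : ℕ) : NumberField.RingOfIntegers ℚ) ∈ v.asIdeal → ∀ 𝔓 ∈ v.primesAbove, ¬ (∀ g ∈ 𝔓.decompositionSubgroup (Field.absoluteGaloisGroup ℚ), ∀ P ∈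 Φ, g • P = P) ∧ ¬ (∀ g ∈ 𝔓.decompositionSubgroup (Field.absoluteGaloisGroup ℚ), ∀ P : WeierstrassCurve.geomTorsion W ((3 : ℕ) : ℤ), g • P - P ∈ Φ)) → W.conductorNorm ℤ = N → Literature.NumberTheory.EllipticCurves.IsImaginaryQuadratic K → Literature.NumberTheory.EllipticCurves.SatisfiesHeegnerHypothesis N K → ∀ (𝔭 : IsDedekindDomain.HeightOneSpectrum (NumberField.RingOfIntegers K)), ((3 : ℕ) : NumberField.RingOfIntegers K) ∈ 𝔭.asIdeal → 𝔭.asIdeal.ramificationIdx (NumberField.RingOfIntegers ℚ) = 1 → 𝔭.asIdeal.inertiaDeg (NumberField.RingOfIntegers ℚ) = 1 → ∀ Q : (W.baseChange K).toAffine.Point, (3 : ℕ) • Q = 0 → Q = 0 := by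
  intro W _ _ N _ K _ _ hO6 _hRed hcell hN hK hHg 𝔭 h𝔭 _he _hf Q hQ
  haveI : Fact (Nat.Prime 3) := ⟨Nat.prime_three⟩
  by_contra hQ0
  -- `Q` has order exactly `3`
  have hord : addOrderOf Q = 3 := by
    rcases (Nat.dvd_prime Nat.prime_three).mp (addOrderOf_dvd_of_nsmul_eq_zero hQ) with h1 | h3
    · exact absurd (AddMonoid.addOrderOf_eq_one_iff.mp h1) hQ0
    · exact h3
  -- its geometric point: non-zero, `Γ_K`-fixed, in `E_K[3]`
  obtain ⟨Pb, -, hPb0, hfix⟩ := exists_geomTorsion_fixed_of_addOrderOf_eq (W.baseChange K) hord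
  -- on the cell no non-zero point of `E_K[3]` is fixed by `D_𝔭`
  exact hPb0 (cell_geomTorsion_eq_zero_of_fixed_decomp W N K hO6 hcell hN hK hHg 𝔭 h𝔭 Pb fun g _ ↦ hfix g)

end Summit.BirchSwinnertonDyer.BirchSwinnertonDyer.Theorems.EisensteinCharacterInvariantsAtThreeCellTorsion

end
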